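import Literature.Geometry.Kaehler.ComplexTorusHodgeGroupSymplecticLieSimple
import Literature.Geometry.Kaehler.ComplexTorusRealPointsConnectedComponents
import Literature.Geometry.Kaehler.ComplexTorusRationalFormsBasis
import HarnessLib

/-!
# `Hg(X) = Sp(V, E)` on REAL points ⟺ `Hg(X)(ℂ) = Sp(V, E)(ℂ)` on COMPLEX points (polarised torus): the real-side
# criteria (`dim_ℝ 𝔥𝔤_ℝ = g(2g+1)`, Gordon 7.5 "stably nondegenerate and `End_ℚ(X) = ℚ`") become `Lie Hg(X)(ℂ)` simple
# and the product splittings; (D) for all powers of `X₁` and of `X₂` ⟹ (D) for all powers of `X₁ × X₂`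

Layer `Literature/Geometry/Kaehler`, namespace `Literature.Geometry.Kaehler.ComplexTorus`; lane `lit-hodgefound`
(Track 2 foundations library), Layer A4; prover seat `lit-hodgefound-p17` (generation 39, self-proposed row g39-#6, the
bridge between the lane's two symplectic vocabularies: the REAL one — `spGroup Φ η = Sp(V, E)(ℝ) ≤ SL(V_ℝ)`,
`hodgeGroup Φ = Hg(X)(ℝ)`, `hodgeGroupLie Φ = 𝔥𝔤_ℝ`, in which `ComplexTorusHodgeLieAlgebraSymplecticDimension`,
`ComplexTorusStablyNondegenerateIffSymplecticHodgeGroup`, … state their criteria — and the COMPLEX one —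
`hodgeGroupC Φ = Hg(X)(ℂ)`, `symplecticGroupC l = Sp_{2l}(ℂ)`, the LAG library's `zdim` / `lieSubalgebraGL`, in which
g38-#5 / g39-#5 state Lie-simplicity and the product theorems). THEOREMS ONLY (no definition, no instance, no
notation, no named fact; D-0026 net debt 0).

The bridge is Zariski density of real points, in the tree as gen-15's `ComplexTorusRealPointsConnectedComponents`:
for a polarised torus `Z̄(Hg(X)(ℝ)⁰ ⊗ 1) = Hg(X)(ℂ)` and `Z̄(Sp(V, E)(ℝ)⁰ ⊗ 1) = Sp(V, E)(ℂ)`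
(`IsRiemannForm.zariskiClosureSL_connectedComponentOfOne_hodgeGroup` / `_spGroup`), so `Hg(X)(ℝ) = Sp(V, E)(ℝ)` forces
`Hg(X)(ℂ) = Sp(V, E)(ℂ)`; the converse is the elementary real-points computation of g39-#5.

## Sources, verbatim

* H. Lange [Lange2023AbelianVarietiesComplex], §7.2.1 (p. 329–330): "`Hg(X)` […] the smallest algebraic subgroup of
  `GL(V)` defined over `ℚ` […] `Sp(V, E)(ℝ) = {M ∈ SL(V_ℝ) | E(M·, M·) = E}`"; §7.2.3 Prop. 7.2.7 (proof: "`Hg(X)(ℝ)`,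
  which is Zariski dense"); §7.3.1 Prop. 7.3.2 ("`Hg(X) = Sp(V, E)`" for the general torus) and its proof
  (pp. 337–338: "`𝔥𝔤(X_J)` is a proper Lie subalgebra of `𝔰𝔭(V, E)` … lower-dimensional").
* T. A. Springer [Springer1998], 13.3.9 (ii) (real points of a connected reductive `ℝ`-group are Zariski dense),
  7.4.7 (3)(b) (`Sp_{2n}` connected semisimple of type `C_n`).
* B. B. Gordon [Gordon1999HodgeAVSurvey], Thm. 7.5 ("(1) `Hdg(Aᵏ) = Div(Aᵏ)` for all `k ≥ 1` ⟺ (2) […]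
  `Hg(A) = Lf(A)`"), Thm. 6.2, Thm. 7.6.2 (Hazama's product theorem); B. Moonen, Yu. G. Zarhin
  [MoonenZarhin1999LowDim], §3 (3.1) and Theorem (2).

## What is proved

* §1 any index type, any rational Gram matrix `G` of the class `E`: `hodgeGroup_eq_spGroup_of_hodgeGroupC_eq_complexPoints_symplecticEqs`
  (complex ⟹ real, no polarisation), **`IsRiemannForm.hodgeGroupC_eq_complexPoints_symplecticEqs_of_hodgeGroup_eq_spGroup`**
  (real ⟹ complex, polarised), **`IsRiemannForm.hodgeGroupC_eq_complexPoints_symplecticEqs_iff_hodgeGroup_eq_spGroup`**.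
* §2 `ι = l ⊕ l`, Gram matrix `J`: **`IsRiemannForm.hodgeGroupC_eq_symplecticGroupC_iff_hodgeGroup_eq_spGroup`**; the
  real criteria ported: **`IsRiemannForm.hodgeGroup_eq_spGroup_iff_zdim_eq`** (`Hg(X) = Sp(V,E) ⟺ dim Hg(X) = l(2l+1)`),
  `…_iff_lieSubalgebraGL_eq_sp`, `…_iff_finrank_lieAlgebraGL_eq`, **`IsRiemannForm.zdim_map_toGL_hodgeGroupC_eq_iff_finrank_hodgeGroupLie_eq`**
  and **`IsRiemannForm.lieSubalgebraGL_eq_sp_iff_hodgeGroupLie_eq`** (the (η)-bridge `Lie Hg(X)(ℂ)` vs `𝔥𝔤_ℝ` at full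
  dimension), **`IsRiemannForm.isSimple_lieSubalgebraGL_map_toGL_hodgeGroupC_of_hodgeGroup_eq_spGroup`**,
  `…_of_finrank_hodgeGroupLie_eq`; GORDON 7.5 ON COMPLEX POINTS: **`IsRiemannForm.hodgeGroupC_eq_symplecticGroupC_iff_forall_divisorClasses_eq_hodgeClasses_and_endAlgRat_eq_bot`**,
  `IsRiemannForm.hodgeGroupC_eq_symplecticGroupC_of_forall_divisorClasses_eq_hodgeClasses`,
  **`IsRiemannForm.isSimple_lieSubalgebraGL_map_toGL_hodgeGroupC_of_forall_divisorClasses_eq_hodgeClasses`** (a stably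
  nondegenerate polarised torus with `End_ℚ(X) = ℚ` has simple `Lie Hg(X)(ℂ) = 𝔰𝔭`), `…zdim…`.
* §3 PRODUCTS IN THE (D)-CURRENCY: **`IsRiemannForm.forall_divisorClasses_powPeriod_prod_eq_hodgeClasses_of_endAlgRat_eq_bot_of_zdim_lt`**
  (`X₁` polarised, `End_ℚ(X₁) = ℚ`, (D) on all powers of `X₁` and of `X₂`, `dim Hg(X₂) < l(2l+1)` ⟹ (D) on all powers of
  `X₁ × X₂`), `…_of_isSolvable`, `IsAbelianVariety.…_of_isCMType`, the `Hg`-splittings behind them, and for two such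
  factors of different dimensions **`IsRiemannForm.forall_divisorClasses_powPeriod_prod_eq_hodgeClasses_of_endAlgRat_eq_bot_of_card_ne`**.

## References

* [Lange2023AbelianVarietiesComplex] H. Lange, *Abelian Varieties over the Complex Numbers*, Springer (2023), §7.2.1,
  Prop. 7.2.3, Prop. 7.2.7, §7.3.1 Prop. 7.3.2.
* [Springer1998] T. A. Springer, *Linear Algebraic Groups*, 2nd ed. (1998), 13.3.9 (ii), 7.4.7.
* [Gordon1999HodgeAVSurvey] B. B. Gordon, *A survey of the Hodge conjecture for abelian varieties* (1999), Thm. 6.2,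
  Thm. 7.5, Thm. 7.6.2.
* [MoonenZarhin1999LowDim] B. Moonen, Yu. G. Zarhin, Math. Ann. 315 (1999), §3 (3.1), Theorem (2).
* [Gordon1997] B. B. Gordon, alg-geom/9709030, §2.16 Proposition, §3 Theorem.
-/

noncomputable section

open Matrix Module

namespace Literature.Geometry.Kaehler

namespace ComplexTorus

open Literature.NumberTheory.Automorphic (IsZConnected lieAlgebraGL lieSubalgebraGL)

/-! ## §1 Real points versus complex points of `Hg(X) ⊆ Sp(V, E)` -/

section General

variable {ι : Type*} [Fintype ι] [DecidableEq ι] {E : Type*} [NormedAddCommGroup E] [NormedSpace ℂ E]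
  (Φ : (ι → ℝ) ≃L[ℝ] E)

/-- The Zariski closure of `H(ℝ)⁰ ⊗ 1` depends only on the subgroup `H`. [folklore] -/
private theorem zariskiClosureSL_connectedComponentOfOne_congr {H H' : Subgroup (SpecialLinearGroup ι ℝ)} (e : H = H') :
    zariskiClosureSL (((Subgroup.connectedComponentOfOne H).map H.subtype).map
        (SpecialLinearGroup.map Complex.ofRealHom)) =
      zariskiClosureSL (((Subgroup.connectedComponentOfOne H').map H'.subtype).map
        (SpecialLinearGroup.map Complex.ofRealHom)) := by
  subst e
  rfl

/-- **`Hg(X)(ℂ) = Sp(V, E)(ℂ) ⟹ Hg(X) = Sp(V, E)`** (real points; `G` any rational Gram matrix of `E`; no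
polarisation needed). [cite: Lange2023AbelianVarietiesComplex, §7.2.1 (p. 329–330: `G(ℝ)`, `Sp(V, E)(ℝ)`)] -/
theorem hodgeGroup_eq_spGroup_of_hodgeGroupC_eq_complexPoints_symplecticEqs {η : E [⋀^Fin 2]→L[ℝ] ℝ}
    {G : Matrix ι ι ℚ} (hG : G.map (Rat.cast : ℚ → ℝ) = latticeGram Φ η)
    (h : hodgeGroupC Φ = (isRatAlgSubgroupEqs_symplecticEqs G).complexPoints) : hodgeGroup Φ = spGroup Φ η := by
  ext M
  rw [← map_ofRealHom_mem_hodgeGroupC_iff, h, IsRatAlgSubgroupEqs.map_ofRealHom_mem_complexPoints_iff,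
    spGroup_eq_realPoints Φ hG]

variable {Φ}

/-- **`Hg(X) = Sp(V, E) ⟹ Hg(X)(ℂ) = Sp(V, E)(ℂ)` for a POLARISED torus**: both complex groups are the Zariski
closures of the topological identity components of their real points (`Hg(X)(ℝ)⁰`, `Sp(V, E)(ℝ)⁰` are Zariski dense).
[cite: Lange2023AbelianVarietiesComplex, §7.2.3 Prop. 7.2.7 (proof: "`Hg(X)(ℝ)`, which is Zariski dense") and §7.2.1 Prop. 7.2.3]
[cite: Springer1998, 13.3.9 (ii)] -/
theorem IsRiemannForm.hodgeGroupC_eq_complexPoints_symplecticEqs_of_hodgeGroup_eq_spGroup {η : E [⋀^Fin 2]→L[ℝ] ℝ}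
    (hη : IsRiemannForm Φ η) {G : Matrix ι ι ℚ} (hG : G.map (Rat.cast : ℚ → ℝ) = latticeGram Φ η)
    (h : hodgeGroup Φ = spGroup Φ η) : hodgeGroupC Φ = (isRatAlgSubgroupEqs_symplecticEqs G).complexPoints := by
  rw [← hη.zariskiClosureSL_connectedComponentOfOne_hodgeGroup, zariskiClosureSL_connectedComponentOfOne_congr h,
    hη.zariskiClosureSL_connectedComponentOfOne_spGroup hG]

/-- **`Hg(X)(ℂ) = Sp(V, E)(ℂ) ⟺ Hg(X) = Sp(V, E)`** (polarised torus, `G` a rational Gram matrix of the polarisation).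
[cite: Lange2023AbelianVarietiesComplex, §7.2.3 Prop. 7.2.7 (proof) and §7.3.1 Prop. 7.3.2] [cite: Springer1998, 13.3.9 (ii)] -/
theorem IsRiemannForm.hodgeGroupC_eq_complexPoints_symplecticEqs_iff_hodgeGroup_eq_spGroup {η : E [⋀^Fin 2]→L[ℝ] ℝ}
    (hη : IsRiemannForm Φ η) {G : Matrix ι ι ℚ} (hG : G.map (Rat.cast : ℚ → ℝ) = latticeGram Φ η) :
    hodgeGroupC Φ = (isRatAlgSubgroupEqs_symplecticEqs G).complexPoints ↔ hodgeGroup Φ = spGroup Φ η :=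
  ⟨hodgeGroup_eq_spGroup_of_hodgeGroupC_eq_complexPoints_symplecticEqs Φ hG,
    hη.hodgeGroupC_eq_complexPoints_symplecticEqs_of_hodgeGroup_eq_spGroup hG⟩

end General

/-! ## §2 Lattice Gram matrix `J`: `Hg(X) = Sp(V, E) ⟺ Hg(X)(ℂ) = Sp_{2l}(ℂ) ⟺ dim Hg(X) = l(2l+1) ⟺ …` -/

section Standard

variable {l : Type*} [Fintype l] [DecidableEq l] {E : Type*} [NormedAddCommGroup E] [NormedSpace ℂ E]
  {Φ : ((l ⊕ l) → ℝ) ≃L[ℝ] E}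

omit [DecidableEq l] in
/-- `dim_ℂ E = l` for a torus `E/Φ(ℤ^{l ⊕ l})`. [cite: Lange2023AbelianVarietiesComplex, §1.1.1] -/
theorem finrank_eq_card_of_sum (Ψ : ((l ⊕ l) → ℝ) ≃L[ℝ] E) [FiniteDimensional ℂ E] : finrank ℂ E = Fintype.card l := by
  have h := card_eq_two_mul_finrank Ψ
  rw [Fintype.card_sum] at h
  omega

/-- **`Hg(X) = Sp(V, E) ⟹ Hg(X)(ℂ) = Sp_{2l}(ℂ)`** (polarised, Gram matrix `J`). [cite: Lange2023AbelianVarietiesComplex, §7.2.3 Prop. 7.2.7 (proof) and §7.3.1 Prop. 7.3.2]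
[cite: Springer1998, 13.3.9 (ii)] -/
theorem IsRiemannForm.hodgeGroupC_eq_symplecticGroupC_of_hodgeGroup_eq_spGroup {η : E [⋀^Fin 2]→L[ℝ] ℝ}
    (hη : IsRiemannForm Φ η) (hG : (Matrix.J l ℚ).map (Rat.cast : ℚ → ℝ) = latticeGram Φ η)
    (h : hodgeGroup Φ = spGroup Φ η) : hodgeGroupC Φ = symplecticGroupC l := by
  rw [symplecticGroupC_eq_complexPoints]
  exact hη.hodgeGroupC_eq_complexPoints_symplecticEqs_of_hodgeGroup_eq_spGroup hG h

/-- **`Hg(X)(ℂ) = Sp_{2l}(ℂ) ⟺ Hg(X) = Sp(V, E)`** (polarised, Gram matrix `J`). [cite: Lange2023AbelianVarietiesComplex, §7.3.1 Prop. 7.3.2]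
[cite: Springer1998, 13.3.9 (ii)] -/
theorem IsRiemannForm.hodgeGroupC_eq_symplecticGroupC_iff_hodgeGroup_eq_spGroup {η : E [⋀^Fin 2]→L[ℝ] ℝ}
    (hη : IsRiemannForm Φ η) (hG : (Matrix.J l ℚ).map (Rat.cast : ℚ → ℝ) = latticeGram Φ η) :
    hodgeGroupC Φ = symplecticGroupC l ↔ hodgeGroup Φ = spGroup Φ η :=
  ⟨hodgeGroup_eq_spGroup_of_hodgeGroupC_eq_symplecticGroupC Φ hG, hη.hodgeGroupC_eq_symplecticGroupC_of_hodgeGroup_eq_spGroup hG⟩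

/-- **`Hg(X) = Sp(V, E) ⟺ dim Hg(X) = l(2l+1)`** (the LAG dimension of `Hg(X)(ℂ)`; polarised, Gram matrix `J`).
[cite: Lange2023AbelianVarietiesComplex, §7.3.1 Prop. 7.3.2 and its proof (pp. 337–338)] [cite: Springer1998, 7.4.7 (3)(b) and 1.8.2] -/
theorem IsRiemannForm.hodgeGroup_eq_spGroup_iff_zdim_eq {η : E [⋀^Fin 2]→L[ℝ] ℝ} (hη : IsRiemannForm Φ η)
    (hG : (Matrix.J l ℚ).map (Rat.cast : ℚ → ℝ) = latticeGram Φ η) :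
    hodgeGroup Φ = spGroup Φ η ↔ (isZConnected_map_toGL_hodgeGroupC Φ).zdim = Fintype.card l * (2 * Fintype.card l + 1) := by
  rw [← hη.hodgeGroupC_eq_symplecticGroupC_iff_hodgeGroup_eq_spGroup hG,
    hodgeGroupC_eq_symplecticGroupC_iff_zdim_eq Φ (ofRealForm_mem_hodgeClasses_one_of_isRiemannForm Φ hη) hG]

/-- `Hg(X) ≠ Sp(V, E) ⟺ dim Hg(X) < l(2l+1)` (polarised, Gram matrix `J`). [cite: Lange2023AbelianVarietiesComplex, §7.3.1, proof of Prop. 7.3.2 ("lower-dimensional")]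
[cite: Springer1998, 1.8.2] -/
theorem IsRiemannForm.hodgeGroup_ne_spGroup_iff_zdim_lt {η : E [⋀^Fin 2]→L[ℝ] ℝ} (hη : IsRiemannForm Φ η)
    (hG : (Matrix.J l ℚ).map (Rat.cast : ℚ → ℝ) = latticeGram Φ η) :
    hodgeGroup Φ ≠ spGroup Φ η ↔ (isZConnected_map_toGL_hodgeGroupC Φ).zdim < Fintype.card l * (2 * Fintype.card l + 1) := by
  rw [Ne, ← hη.hodgeGroupC_eq_symplecticGroupC_iff_hodgeGroup_eq_spGroup hG]
  exact hodgeGroupC_ne_symplecticGroupC_iff_zdim_lt Φ (ofRealForm_mem_hodgeClasses_one_of_isRiemannForm Φ hη) hG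

/-- **`Hg(X) = Sp(V, E) ⟺ Lie Hg(X)(ℂ) = 𝔰𝔭_{2l}(ℂ)`** (the LAG tangent algebra; polarised, Gram matrix `J`).
[cite: Lange2023AbelianVarietiesComplex, §7.3.1, proof of Prop. 7.3.3 ("`Hg(X)(ℂ) = Sp(V, E)(ℂ) ≃ Sp_{2g}(ℂ)`")] [cite: Springer1998, 7.4.7 (5) and 4.4.6] -/
theorem IsRiemannForm.hodgeGroup_eq_spGroup_iff_lieSubalgebraGL_eq_sp {η : E [⋀^Fin 2]→L[ℝ] ℝ} (hη : IsRiemannForm Φ η)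
    (hG : (Matrix.J l ℚ).map (Rat.cast : ℚ → ℝ) = latticeGram Φ η) :
    hodgeGroup Φ = spGroup Φ η ↔
      lieSubalgebraGL ((hodgeGroupC Φ).map Matrix.SpecialLinearGroup.toGL) = LieAlgebra.Symplectic.sp l ℂ := by
  rw [← hη.hodgeGroupC_eq_symplecticGroupC_iff_hodgeGroup_eq_spGroup hG,
    hodgeGroupC_eq_symplecticGroupC_iff_lieSubalgebraGL_eq_sp Φ (ofRealForm_mem_hodgeClasses_one_of_isRiemannForm Φ hη) hG]

/-- `Hg(X) = Sp(V, E) ⟺ dim_ℂ Lie Hg(X)(ℂ) = l(2l+1)` (polarised, Gram matrix `J`). [cite: Lange2023AbelianVarietiesComplex, §7.3.1, proof of Prop. 7.3.2]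
[cite: Springer1998, 4.4.6] -/
theorem IsRiemannForm.hodgeGroup_eq_spGroup_iff_finrank_lieAlgebraGL_eq {η : E [⋀^Fin 2]→L[ℝ] ℝ} (hη : IsRiemannForm Φ η)
    (hG : (Matrix.J l ℚ).map (Rat.cast : ℚ → ℝ) = latticeGram Φ η) :
    hodgeGroup Φ = spGroup Φ η ↔
      finrank ℂ (lieAlgebraGL ((hodgeGroupC Φ).map Matrix.SpecialLinearGroup.toGL)) =
        Fintype.card l * (2 * Fintype.card l + 1) := by
  rw [← hη.hodgeGroupC_eq_symplecticGroupC_iff_hodgeGroup_eq_spGroup hG,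
    hodgeGroupC_eq_symplecticGroupC_iff_finrank_lieAlgebraGL_eq Φ (ofRealForm_mem_hodgeClasses_one_of_isRiemannForm Φ hη) hG]

/-- **The (η)-bridge at full dimension: `dim Hg(X) = l(2l+1) ⟺ dim_ℝ 𝔥𝔤_ℝ = l(2l+1)`** — the LAG dimension of
`Hg(X)(ℂ)` and the dimension of the real Lie algebra `𝔥𝔤_ℝ = Lie Hg(X)(ℝ)` detect `Hg = Sp` simultaneously (polarised,
Gram matrix `J`). [cite: Lange2023AbelianVarietiesComplex, §7.3.1, proof of Prop. 7.3.2 (pp. 337–338)] [cite: Springer1998, 4.4.6 and 1.8.2] -/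
theorem IsRiemannForm.zdim_map_toGL_hodgeGroupC_eq_iff_finrank_hodgeGroupLie_eq [FiniteDimensional ℂ E]
    {η : E [⋀^Fin 2]→L[ℝ] ℝ} (hη : IsRiemannForm Φ η) (hG : (Matrix.J l ℚ).map (Rat.cast : ℚ → ℝ) = latticeGram Φ η) :
    (isZConnected_map_toGL_hodgeGroupC Φ).zdim = Fintype.card l * (2 * Fintype.card l + 1) ↔
      finrank ℝ (hodgeGroupLie Φ) = Fintype.card l * (2 * Fintype.card l + 1) := by
  rw [← hη.hodgeGroup_eq_spGroup_iff_zdim_eq hG, hη.hodgeGroup_eq_spGroup_iff_finrank_hodgeGroupLie_eq,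
    finrank_eq_card_of_sum Φ]

/-- **`Lie Hg(X)(ℂ) = 𝔰𝔭_{2l}(ℂ) ⟺ 𝔥𝔤_ℝ = 𝔰𝔭(V, E)`** (complex LAG tangent algebra versus real Lie algebra; polarised,
Gram matrix `J`). [cite: Lange2023AbelianVarietiesComplex, §7.3.1, proof of Prop. 7.3.2 (p. 337)] [cite: Springer1998, 7.4.7 (5)] -/
theorem IsRiemannForm.lieSubalgebraGL_eq_sp_iff_hodgeGroupLie_eq {η : E [⋀^Fin 2]→L[ℝ] ℝ} (hη : IsRiemannForm Φ η)
    (hG : (Matrix.J l ℚ).map (Rat.cast : ℚ → ℝ) = latticeGram Φ η) :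
    lieSubalgebraGL ((hodgeGroupC Φ).map Matrix.SpecialLinearGroup.toGL) = LieAlgebra.Symplectic.sp l ℂ ↔
      hodgeGroupLie Φ = skewAdjointMatricesLieSubalgebra (latticeGram Φ η) := by
  rw [← hη.hodgeGroup_eq_spGroup_iff_lieSubalgebraGL_eq_sp hG, hη.hodgeGroup_eq_spGroup_iff_hodgeGroupLie_eq]

/-- **`Hg(X) = Sp(V, E) ⟹ Lie Hg(X)(ℂ)` IS SIMPLE** (polarised, Gram matrix `J`, `l` non-empty).
[cite: Lange2023AbelianVarietiesComplex, §7.3.1 Prop. 7.3.2] [cite: Springer1998, 7.4.7 (3)(b)] [cite: Humphreys1972, §19.2] -/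
theorem IsRiemannForm.isSimple_lieSubalgebraGL_map_toGL_hodgeGroupC_of_hodgeGroup_eq_spGroup [Nonempty l]
    {η : E [⋀^Fin 2]→L[ℝ] ℝ} (hη : IsRiemannForm Φ η) (hG : (Matrix.J l ℚ).map (Rat.cast : ℚ → ℝ) = latticeGram Φ η)
    (h : hodgeGroup Φ = spGroup Φ η) :
    LieAlgebra.IsSimple ℂ (lieSubalgebraGL ((hodgeGroupC Φ).map Matrix.SpecialLinearGroup.toGL)) :=
  isSimple_lieSubalgebraGL_map_toGL_hodgeGroupC_of_eq_symplecticGroupC Φ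
    (hη.hodgeGroupC_eq_symplecticGroupC_of_hodgeGroup_eq_spGroup hG h)

/-- **`dim_ℝ 𝔥𝔤_ℝ = l(2l+1) ⟹ Lie Hg(X)(ℂ)` is simple** (the lane's real dimension criterion, ported).
[cite: Lange2023AbelianVarietiesComplex, §7.3.1, proof of Prop. 7.3.2 (pp. 337–338)] [cite: Humphreys1972, §19.2] -/
theorem IsRiemannForm.isSimple_lieSubalgebraGL_map_toGL_hodgeGroupC_of_finrank_hodgeGroupLie_eq [Nonempty l]
    [FiniteDimensional ℂ E] {η : E [⋀^Fin 2]→L[ℝ] ℝ} (hη : IsRiemannForm Φ η)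
    (hG : (Matrix.J l ℚ).map (Rat.cast : ℚ → ℝ) = latticeGram Φ η)
    (h : finrank ℝ (hodgeGroupLie Φ) = Fintype.card l * (2 * Fintype.card l + 1)) :
    LieAlgebra.IsSimple ℂ (lieSubalgebraGL ((hodgeGroupC Φ).map Matrix.SpecialLinearGroup.toGL)) :=
  hη.isSimple_lieSubalgebraGL_map_toGL_hodgeGroupC_of_hodgeGroup_eq_spGroup hG
    ((hη.hodgeGroup_eq_spGroup_iff_finrank_hodgeGroupLie_eq.2 (by rwa [finrank_eq_card_of_sum Φ])))

/-- **GORDON 7.5 ON COMPLEX POINTS: `Hg(X)(ℂ) = Sp_{2l}(ℂ)` ⟺ (`X` stably nondegenerate and `End_ℚ(X) = ℚ`)**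
(polarised, Gram matrix `J`). [cite: Gordon1999HodgeAVSurvey, Thm. 7.5 ((1) ⟺ (2)) and Thm. 6.2] [cite: Lange2023AbelianVarietiesComplex, §7.3.1 Prop. 7.3.2 and §7.2.4 Exercise (4)] -/
theorem IsRiemannForm.hodgeGroupC_eq_symplecticGroupC_iff_forall_divisorClasses_eq_hodgeClasses_and_endAlgRat_eq_bot
    [FiniteDimensional ℂ E] {η : E [⋀^Fin 2]→L[ℝ] ℝ} (hη : IsRiemannForm Φ η)
    (hG : (Matrix.J l ℚ).map (Rat.cast : ℚ → ℝ) = latticeGram Φ η) :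
    hodgeGroupC Φ = symplecticGroupC l ↔
      (∀ k p : ℕ, divisorClasses (powPeriod Φ k) p = hodgeClasses (powPeriod Φ k) p) ∧ endAlgRat Φ = ⊥ := by
  rw [hη.hodgeGroupC_eq_symplecticGroupC_iff_hodgeGroup_eq_spGroup hG,
    hη.hodgeGroup_eq_spGroup_iff_forall_divisorClasses_eq_hodgeClasses_and_endAlgRat_eq_bot]

/-- **A stably nondegenerate polarised torus with `End_ℚ(X) = ℚ` has `Hg(X)(ℂ) = Sp_{2l}(ℂ)`** (Gram matrix `J`).
[cite: Gordon1999HodgeAVSurvey, Thm. 7.5 ((1) ⟹ (2)) and Thm. 6.2] [cite: Lange2023AbelianVarietiesComplex, §7.2.4 Exercise (4)] -/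
theorem IsRiemannForm.hodgeGroupC_eq_symplecticGroupC_of_forall_divisorClasses_eq_hodgeClasses [FiniteDimensional ℂ E]
    {η : E [⋀^Fin 2]→L[ℝ] ℝ} (hη : IsRiemannForm Φ η) (hG : (Matrix.J l ℚ).map (Rat.cast : ℚ → ℝ) = latticeGram Φ η)
    (hE : endAlgRat Φ = ⊥) (hD : ∀ k p : ℕ, divisorClasses (powPeriod Φ k) p = hodgeClasses (powPeriod Φ k) p) :
    hodgeGroupC Φ = symplecticGroupC l :=
  (hη.hodgeGroupC_eq_symplecticGroupC_iff_forall_divisorClasses_eq_hodgeClasses_and_endAlgRat_eq_bot hG).2 ⟨hD, hE⟩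

/-- **A stably nondegenerate polarised torus with `End_ℚ(X) = ℚ` has SIMPLE `Lie Hg(X)(ℂ)` (`= 𝔰𝔭_{2l}(ℂ)`).**
[cite: Gordon1999HodgeAVSurvey, Thm. 7.5 ((1) ⟹ (2))] [cite: Springer1998, 7.4.7 (3)(b)] [cite: Humphreys1972, §19.2] -/
theorem IsRiemannForm.isSimple_lieSubalgebraGL_map_toGL_hodgeGroupC_of_forall_divisorClasses_eq_hodgeClasses [Nonempty l]
    [FiniteDimensional ℂ E] {η : E [⋀^Fin 2]→L[ℝ] ℝ} (hη : IsRiemannForm Φ η)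
    (hG : (Matrix.J l ℚ).map (Rat.cast : ℚ → ℝ) = latticeGram Φ η) (hE : endAlgRat Φ = ⊥)
    (hD : ∀ k p : ℕ, divisorClasses (powPeriod Φ k) p = hodgeClasses (powPeriod Φ k) p) :
    LieAlgebra.IsSimple ℂ (lieSubalgebraGL ((hodgeGroupC Φ).map Matrix.SpecialLinearGroup.toGL)) :=
  isSimple_lieSubalgebraGL_map_toGL_hodgeGroupC_of_eq_symplecticGroupC Φ
    (hη.hodgeGroupC_eq_symplecticGroupC_of_forall_divisorClasses_eq_hodgeClasses hG hE hD)

/-- `X` stably nondegenerate with `End_ℚ(X) = ℚ` ⟹ `dim Hg(X) = l(2l+1)` (polarised, Gram matrix `J`).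
[cite: Gordon1999HodgeAVSurvey, Thm. 7.5 ((1) ⟹ (2))] [cite: Springer1998, 7.4.7 (3)(b) and 1.8.2] -/
theorem IsRiemannForm.zdim_map_toGL_hodgeGroupC_eq_of_forall_divisorClasses_eq_hodgeClasses [FiniteDimensional ℂ E]
    {η : E [⋀^Fin 2]→L[ℝ] ℝ} (hη : IsRiemannForm Φ η) (hG : (Matrix.J l ℚ).map (Rat.cast : ℚ → ℝ) = latticeGram Φ η)
    (hE : endAlgRat Φ = ⊥) (hD : ∀ k p : ℕ, divisorClasses (powPeriod Φ k) p = hodgeClasses (powPeriod Φ k) p) :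
    (isZConnected_map_toGL_hodgeGroupC Φ).zdim = Fintype.card l * (2 * Fintype.card l + 1) :=
  zdim_map_toGL_hodgeGroupC_of_eq_symplecticGroupC Φ
    (hη.hodgeGroupC_eq_symplecticGroupC_of_forall_divisorClasses_eq_hodgeClasses hG hE hD)

/-- `X` polarised with `End_ℚ(X) = ℚ` but `dim Hg(X) < l(2l+1)` ⟹ some power `Xᵏ` carries a Hodge class that is
not generated by divisors (contrapositive of Gordon 7.5 (1) ⟹ (2)). [cite: Gordon1999HodgeAVSurvey, Thm. 7.5] [cite: Springer1998, 1.8.2] -/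
theorem IsRiemannForm.exists_divisorClasses_ne_hodgeClasses_of_zdim_lt [FiniteDimensional ℂ E]
    {η : E [⋀^Fin 2]→L[ℝ] ℝ} (hη : IsRiemannForm Φ η) (hG : (Matrix.J l ℚ).map (Rat.cast : ℚ → ℝ) = latticeGram Φ η)
    (hE : endAlgRat Φ = ⊥)
    (hlt : (isZConnected_map_toGL_hodgeGroupC Φ).zdim < Fintype.card l * (2 * Fintype.card l + 1)) :
    ∃ k p : ℕ, divisorClasses (powPeriod Φ k) p ≠ hodgeClasses (powPeriod Φ k) p := by
  by_contra! hD
  exact (Nat.lt_irrefl _) ((hη.zdim_map_toGL_hodgeGroupC_eq_of_forall_divisorClasses_eq_hodgeClasses hG hE hD) ▸ hlt)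

end Standard

/-! ## §3 Products in the (D)-currency -/

section Product

variable {l : Type*} [Fintype l] [DecidableEq l] {ι₂ : Type*} [Fintype ι₂] [DecidableEq ι₂]
  {E₁ E₂ : Type*} [NormedAddCommGroup E₁] [NormedSpace ℂ E₁] [NormedAddCommGroup E₂] [NormedSpace ℂ E₂]
  {Φ₁ : ((l ⊕ l) → ℝ) ≃L[ℝ] E₁} (Φ₂ : (ι₂ → ℝ) ≃L[ℝ] E₂)

/-- **`Hg(X₁) = Sp(V, E)` (real points, polarised, Gram `J`) and `dim Hg(X₂) < l(2l+1)` ⟹ `Hg(X₁ × X₂)(ℂ) =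
Hg(X₁)(ℂ) × Hg(X₂)(ℂ)`.** [cite: MoonenZarhin1999LowDim, §3 (3.1)] [cite: Gordon1997, §2.16 Proposition] [cite: Lange2023AbelianVarietiesComplex, §7.3.1 Prop. 7.3.2] -/
theorem IsRiemannForm.hodgeGroupC_prod_eq_blockDiagProd_of_hodgeGroup_eq_spGroup_of_zdim_lt [Nonempty l]
    {η₁ : E₁ [⋀^Fin 2]→L[ℝ] ℝ} (hη₁ : IsRiemannForm Φ₁ η₁) (hG₁ : (Matrix.J l ℚ).map (Rat.cast : ℚ → ℝ) = latticeGram Φ₁ η₁)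
    (h₁ : hodgeGroup Φ₁ = spGroup Φ₁ η₁)
    (hlt : (isZConnected_map_toGL_hodgeGroupC Φ₂).zdim < Fintype.card l * (2 * Fintype.card l + 1)) :
    hodgeGroupC (prodPeriod Φ₁ Φ₂) = blockDiagProd (hodgeGroupC Φ₁) (hodgeGroupC Φ₂) :=
  hodgeGroupC_prod_eq_blockDiagProd_of_eq_symplecticGroupC_of_zdim_lt Φ₁ Φ₂
    (hη₁.hodgeGroupC_eq_symplecticGroupC_of_hodgeGroup_eq_spGroup hG₁ h₁) hlt

/-- `Hg(X₁) = Sp(V, E)` (real points, polarised, Gram `J`) and `Hg(X₂)(ℂ)` solvable ⟹ split.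
[cite: Gordon1997, §2.16 Proposition and §3 Theorem, proof] [cite: MoonenZarhin1999LowDim, §3 Theorem (2)] -/
theorem IsRiemannForm.hodgeGroupC_prod_eq_blockDiagProd_of_hodgeGroup_eq_spGroup_of_isSolvable [Nonempty l]
    {η₁ : E₁ [⋀^Fin 2]→L[ℝ] ℝ} (hη₁ : IsRiemannForm Φ₁ η₁) (hG₁ : (Matrix.J l ℚ).map (Rat.cast : ℚ → ℝ) = latticeGram Φ₁ η₁)
    (h₁ : hodgeGroup Φ₁ = spGroup Φ₁ η₁) (h₂ : IsSolvable ↥(hodgeGroupC Φ₂)) :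
    hodgeGroupC (prodPeriod Φ₁ Φ₂) = blockDiagProd (hodgeGroupC Φ₁) (hodgeGroupC Φ₂) :=
  hodgeGroupC_prod_eq_blockDiagProd_of_eq_symplecticGroupC_of_isSolvable Φ₁ Φ₂
    (hη₁.hodgeGroupC_eq_symplecticGroupC_of_hodgeGroup_eq_spGroup hG₁ h₁) h₂

/-- **HAZAMA–MURTY IN THE LANE'S (D)-CURRENCY, DIMENSION ROUTE: `X₁` polarised (Gram `J`) with `End_ℚ(X₁) = ℚ`,
(D) on all powers of `X₁` and of `X₂`, and `dim Hg(X₂) < l(2l+1)` ⟹ (D) on all powers of `X₁ × X₂`** — every Hodge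
class on every `(X₁ × X₂)ᵏ` is generated by divisor classes. [cite: Gordon1999HodgeAVSurvey, Thm. 7.5 and Thm. 7.6.2]
[cite: MoonenZarhin1999LowDim, §3 (3.1)] -/
theorem IsRiemannForm.forall_divisorClasses_powPeriod_prod_eq_hodgeClasses_of_endAlgRat_eq_bot_of_zdim_lt [Nonempty l]
    [FiniteDimensional ℂ E₁] {η₁ : E₁ [⋀^Fin 2]→L[ℝ] ℝ} (hη₁ : IsRiemannForm Φ₁ η₁)
    (hG₁ : (Matrix.J l ℚ).map (Rat.cast : ℚ → ℝ) = latticeGram Φ₁ η₁) (hE₁ : endAlgRat Φ₁ = ⊥)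
    (hX₁ : ∀ k p, divisorClasses (powPeriod Φ₁ k) p = hodgeClasses (powPeriod Φ₁ k) p)
    (hlt : (isZConnected_map_toGL_hodgeGroupC Φ₂).zdim < Fintype.card l * (2 * Fintype.card l + 1))
    (hX₂ : ∀ k p, divisorClasses (powPeriod Φ₂ k) p = hodgeClasses (powPeriod Φ₂ k) p) :
    ∀ k p, divisorClasses (powPeriod (prodPeriod Φ₁ Φ₂) k) p = hodgeClasses (powPeriod (prodPeriod Φ₁ Φ₂) k) p :=
  forall_divisorClasses_powPeriod_prod_eq_hodgeClasses_of_hodgeGroupC_prod_eq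
    (hodgeGroupC_prod_eq_blockDiagProd_of_eq_symplecticGroupC_of_zdim_lt Φ₁ Φ₂
      (hη₁.hodgeGroupC_eq_symplecticGroupC_of_forall_divisorClasses_eq_hodgeClasses hG₁ hE₁ hX₁) hlt) hX₁ hX₂

/-- **HAZAMA–MURTY IN THE (D)-CURRENCY, GORDON'S LEMMA: `X₁` polarised (Gram `J`) with `End_ℚ(X₁) = ℚ`, (D) on all
powers of `X₁` and of `X₂`, `Hg(X₂)(ℂ)` solvable ⟹ (D) on all powers of `X₁ × X₂`.**
[cite: Gordon1999HodgeAVSurvey, Thm. 7.5 and Thm. 7.6.2] [cite: Gordon1997, §3 Theorem, proof] [cite: MoonenZarhin1999LowDim, §3 Theorem (2)] -/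
theorem IsRiemannForm.forall_divisorClasses_powPeriod_prod_eq_hodgeClasses_of_endAlgRat_eq_bot_of_isSolvable [Nonempty l]
    [FiniteDimensional ℂ E₁] {η₁ : E₁ [⋀^Fin 2]→L[ℝ] ℝ} (hη₁ : IsRiemannForm Φ₁ η₁)
    (hG₁ : (Matrix.J l ℚ).map (Rat.cast : ℚ → ℝ) = latticeGram Φ₁ η₁) (hE₁ : endAlgRat Φ₁ = ⊥)
    (hX₁ : ∀ k p, divisorClasses (powPeriod Φ₁ k) p = hodgeClasses (powPeriod Φ₁ k) p)
    (h₂ : IsSolvable ↥(hodgeGroupC Φ₂))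
    (hX₂ : ∀ k p, divisorClasses (powPeriod Φ₂ k) p = hodgeClasses (powPeriod Φ₂ k) p) :
    ∀ k p, divisorClasses (powPeriod (prodPeriod Φ₁ Φ₂) k) p = hodgeClasses (powPeriod (prodPeriod Φ₁ Φ₂) k) p :=
  forall_divisorClasses_powPeriod_prod_eq_hodgeClasses_of_hodgeGroupC_prod_eq
    (hodgeGroupC_prod_eq_blockDiagProd_of_eq_symplecticGroupC_of_isSolvable Φ₁ Φ₂
      (hη₁.hodgeGroupC_eq_symplecticGroupC_of_forall_divisorClasses_eq_hodgeClasses hG₁ hE₁ hX₁) h₂) hX₁ hX₂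

variable {Φ₂} in
/-- **… CM SECOND FACTOR: `X₁` polarised (Gram `J`) with `End_ℚ(X₁) = ℚ` and (D) on all its powers, `X₂` an abelian
variety of CM-type with (D) on all its powers ⟹ (D) on all powers of `X₁ × X₂`.** [cite: MoonenZarhin1999LowDim, §3 Theorem (2)]
[cite: Gordon1999HodgeAVSurvey, Thm. 7.5 and Thm. 7.6.2] [cite: Gordon1997, §2.12 Proposition] -/
theorem IsRiemannForm.forall_divisorClasses_powPeriod_prod_eq_hodgeClasses_of_endAlgRat_eq_bot_of_isCMType [Nonempty l]
    [FiniteDimensional ℂ E₁] {η₁ : E₁ [⋀^Fin 2]→L[ℝ] ℝ} (hη₁ : IsRiemannForm Φ₁ η₁)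
    (hG₁ : (Matrix.J l ℚ).map (Rat.cast : ℚ → ℝ) = latticeGram Φ₁ η₁) (hE₁ : endAlgRat Φ₁ = ⊥)
    (hX₁ : ∀ k p, divisorClasses (powPeriod Φ₁ k) p = hodgeClasses (powPeriod Φ₁ k) p)
    (hX₂ : IsAbelianVariety Φ₂)
    (hCM : ∃ T : Subalgebra ℚ (Matrix ι₂ ι₂ ℚ), T ≤ endAlgRat Φ₂ ∧ IsReduced T ∧ (∀ a ∈ T, ∀ b ∈ T, a * b = b * a) ∧
      Module.finrank ℚ T = Fintype.card ι₂)
    (hD₂ : ∀ k p, divisorClasses (powPeriod Φ₂ k) p = hodgeClasses (powPeriod Φ₂ k) p) :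
    ∀ k p, divisorClasses (powPeriod (prodPeriod Φ₁ Φ₂) k) p = hodgeClasses (powPeriod (prodPeriod Φ₁ Φ₂) k) p :=
  forall_divisorClasses_powPeriod_prod_eq_hodgeClasses_of_hodgeGroupC_prod_eq
    (hX₂.hodgeGroupC_prod_eq_blockDiagProd_of_eq_symplecticGroupC_of_isCMType Φ₁
      (hη₁.hodgeGroupC_eq_symplecticGroupC_of_forall_divisorClasses_eq_hodgeClasses hG₁ hE₁ hX₁) hCM) hX₁ hD₂

end Product

/-! ## §4 Two polarised factors with `End_ℚ = ℚ` of different dimensions -/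

section Two

variable {l₁ l₂ : Type*} [Fintype l₁] [DecidableEq l₁] [Fintype l₂] [DecidableEq l₂]
  {E₁ E₂ : Type*} [NormedAddCommGroup E₁] [NormedSpace ℂ E₁] [NormedAddCommGroup E₂] [NormedSpace ℂ E₂]
  {Φ₁ : ((l₁ ⊕ l₁) → ℝ) ≃L[ℝ] E₁} {Φ₂ : ((l₂ ⊕ l₂) → ℝ) ≃L[ℝ] E₂}

/-- **`Hg(X₁) = Sp(V₁, E₁)`, `Hg(X₂) = Sp(V₂, E₂)` on real points (polarised, Gram `J`), `dim X₁ ≠ dim X₂` ⟹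
`Hg(X₁ × X₂)(ℂ) = Hg(X₁)(ℂ) × Hg(X₂)(ℂ)`.** [cite: MoonenZarhin1999LowDim, §3 (3.1)] [cite: Gordon1997, §2.16 Proposition]
[cite: Lange2023AbelianVarietiesComplex, §7.3.1 Prop. 7.3.2] -/
theorem IsRiemannForm.hodgeGroupC_prod_eq_blockDiagProd_of_hodgeGroup_eq_spGroup_of_card_ne [Nonempty l₁] [Nonempty l₂]
    {η₁ : E₁ [⋀^Fin 2]→L[ℝ] ℝ} {η₂ : E₂ [⋀^Fin 2]→L[ℝ] ℝ} (hη₁ : IsRiemannForm Φ₁ η₁) (hη₂ : IsRiemannForm Φ₂ η₂)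
    (hG₁ : (Matrix.J l₁ ℚ).map (Rat.cast : ℚ → ℝ) = latticeGram Φ₁ η₁)
    (hG₂ : (Matrix.J l₂ ℚ).map (Rat.cast : ℚ → ℝ) = latticeGram Φ₂ η₂)
    (h₁ : hodgeGroup Φ₁ = spGroup Φ₁ η₁) (h₂ : hodgeGroup Φ₂ = spGroup Φ₂ η₂) (hne : Fintype.card l₁ ≠ Fintype.card l₂) :
    hodgeGroupC (prodPeriod Φ₁ Φ₂) = blockDiagProd (hodgeGroupC Φ₁) (hodgeGroupC Φ₂) :=
  hodgeGroupC_prod_eq_blockDiagProd_of_eq_symplecticGroupC_of_card_ne Φ₁ Φ₂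
    (hη₁.hodgeGroupC_eq_symplecticGroupC_of_hodgeGroup_eq_spGroup hG₁ h₁)
    (hη₂.hodgeGroupC_eq_symplecticGroupC_of_hodgeGroup_eq_spGroup hG₂ h₂) hne

/-- **TWO STABLY NONDEGENERATE POLARISED TORI WITH `End_ℚ = ℚ` OF DIFFERENT DIMENSIONS: `X₁ × X₂` IS STABLY
NONDEGENERATE** — (D) on all powers of `X₁` and of `X₂` ⟹ (D) on all powers of `X₁ × X₂` (Gram matrices `J`).
[cite: Gordon1999HodgeAVSurvey, Thm. 7.5 and Thm. 7.6.2] [cite: MoonenZarhin1999LowDim, §3 (3.1)] -/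
theorem IsRiemannForm.forall_divisorClasses_powPeriod_prod_eq_hodgeClasses_of_endAlgRat_eq_bot_of_card_ne
    [Nonempty l₁] [Nonempty l₂] [FiniteDimensional ℂ E₁] [FiniteDimensional ℂ E₂]
    {η₁ : E₁ [⋀^Fin 2]→L[ℝ] ℝ} {η₂ : E₂ [⋀^Fin 2]→L[ℝ] ℝ} (hη₁ : IsRiemannForm Φ₁ η₁) (hη₂ : IsRiemannForm Φ₂ η₂)
    (hG₁ : (Matrix.J l₁ ℚ).map (Rat.cast : ℚ → ℝ) = latticeGram Φ₁ η₁)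
    (hG₂ : (Matrix.J l₂ ℚ).map (Rat.cast : ℚ → ℝ) = latticeGram Φ₂ η₂)
    (hE₁ : endAlgRat Φ₁ = ⊥) (hE₂ : endAlgRat Φ₂ = ⊥)
    (hX₁ : ∀ k p, divisorClasses (powPeriod Φ₁ k) p = hodgeClasses (powPeriod Φ₁ k) p)
    (hX₂ : ∀ k p, divisorClasses (powPeriod Φ₂ k) p = hodgeClasses (powPeriod Φ₂ k) p)
    (hne : Fintype.card l₁ ≠ Fintype.card l₂) :
    ∀ k p, divisorClasses (powPeriod (prodPeriod Φ₁ Φ₂) k) p = hodgeClasses (powPeriod (prodPeriod Φ₁ Φ₂) k) p :=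
  forall_divisorClasses_powPeriod_prod_eq_hodgeClasses_of_hodgeGroupC_prod_eq
    (hodgeGroupC_prod_eq_blockDiagProd_of_eq_symplecticGroupC_of_card_ne Φ₁ Φ₂
      (hη₁.hodgeGroupC_eq_symplecticGroupC_of_forall_divisorClasses_eq_hodgeClasses hG₁ hE₁ hX₁)
      (hη₂.hodgeGroupC_eq_symplecticGroupC_of_forall_divisorClasses_eq_hodgeClasses hG₂ hE₂ hX₂) hne) hX₁ hX₂

end Two

end ComplexTorus

end Literature.Geometry.Kaehler

end
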